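import Summits.AtomisticToContinuum.Crystallization.Theorems.FrustratedLawDichotomyThirteenthNeighbourGapHcp
import Summits.AtomisticToContinuum.Crystallization.Theorems.FrustratedLawDichotomyChargedGapRigidityDoor

/-!
# FrustratedLawDichotomy · crux `AperiodicFrustratedLawGap` (stmt-AtomisticToContinuum-27623) — KR ⟸ KR_shape: the kissing-rigidity hypothesis
# of the `ChargedEnergyGap` edge reduced to the PURE SHAPE statement about the bonded dozen (decomp-a2c, prover hand 2, structural share,
# generation 7; critic row 388 (2): «split KR := KR_shape ∧ KR_gap, prove KR_gap, type KR_shape as the census-facing residual»)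

`KR` (hypothesis of `FrustratedLawDichotomyChargedGapRigidityDoor.frustrationDensityGap_of_chargedEnergyGap`): every charge-free(1/100) site of a
finite injective `7/10`-separated configuration is ROBUSTLY GOOD in the set of its atoms.  With KR_gap proved for both patterns
(`…ThirteenthNeighbourGap.thirteenth_neighbour_gap_fcc`, `…ThirteenthNeighbourGapHcp.thirteenth_neighbour_gap_hcp`) it reduces to

* `KR_shape` (census line I-RIG′, finite-dimensional, `≤ 13` points, scale-free): at a charge-free(1/100) site `i` (twelve `1/100`-bonds, each of
  ring number `4`) the bonded dozen, indexed by a bijection `τ` from the fcc or the hcp kissing pattern onto the bond-neighbours of `i`, lies within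
  `η·nn_i` of `nn_i·A(pattern)` for some linear isometry `A` and some `η < 1/20` (`nn_i` = `Literature…nearestDist y i`).

* `kr_of_krShape` : `KR_shape → KR`.  Proof: scale `d = nn_i ≥ 7/10`, gap `γ = d/100`; the shell is the bonded dozen; every other atom `y k` is at
  distance `≥ d` from `y i` (definition of `nn_i`) and, if `dist < 131/100·d`, KR_gap puts it within `< 100/101·d` of a bonded neighbour `y (τ u)`,
  contradicting `dist (y (τ u)) (y k) ≥ nn_(τ u) ≥ dist (y i) (y (τ u))/1.01 ≥ 100/101·d` (the bond inequality read at `τ u`); bonded neighbours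
  themselves sit at `≤ 101/100·d ≤ 129/100·d`.
* `frustrationDensityGap_of_chargedEnergyGap_of_krShape`, `aperiodicFrustratedLawGap_of_chargedEnergyGap_of_krShape`,
  `noFrustratedPeriodicMinimiser_of_chargedEnergyGap_of_krShape` : the concordance edge with `KR_shape` in place of `KR`.
`[folklore]` bookkeeping on the BondGraph vocabulary.
-/

noncomputable section

namespace Summit.AtomisticToContinuum.Crystallization.Theorems.FrustratedLawDichotomyKissingRigidityShape

open Literature.Geometry.DiscreteGeometry
open Summit.AtomisticToContinuum.Crystallization.Theses.PricedLinkCensus (ChargedEnergyGap)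
open Summit.AtomisticToContinuum.Crystallization.Theorems.FrustratedLawDichotomyThirteenthNeighbourGap (thirteenth_neighbour_gap_fcc)
open Summit.AtomisticToContinuum.Crystallization.Theorems.FrustratedLawDichotomyThirteenthNeighbourGapHcp (thirteenth_neighbour_gap_hcp)
open Summit.AtomisticToContinuum.Crystallization.Theorems.FrustratedLawDichotomyChargedGapRigidityDoor
  (frustrationDensityGap_of_chargedEnergyGap aperiodicFrustratedLawGap_of_chargedEnergyGap noFrustratedPeriodicMinimiser_of_chargedEnergyGap)

/-- **The transfer for one pattern.**  Charge-free site `i`, bonded dozen indexed by `τ : Pat → Fin N` within `η·d` of `d·A(Pat)`, `d = nn_i`,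
`η < 1/20`, and KR_gap for `Pat` ⟹ `y i` is robustly good in `range y` with data `(d, η, d/100, A, y ∘ τ)`. [folklore] -/
theorem robustGood_of_shape {N : ℕ} {y : Fin N → EuclideanSpace ℝ (Fin 3)} (hy : Function.Injective y)
    (hsep : ∀ a b : Fin N, a ≠ b → (7 : ℝ) / 10 ≤ dist (y a) (y b)) {i : Fin N}
    {Pat : Finset (EuclideanSpace ℝ (Fin 3))}
    (hgap : ∀ {p q : EuclideanSpace ℝ (Fin 3)} {d η : ℝ} {A : EuclideanSpace ℝ (Fin 3) →ₗᵢ[ℝ] EuclideanSpace ℝ (Fin 3)} {t : ↥Pat → EuclideanSpace ℝ (Fin 3)}, 0 < d → η ≤ 1 / 20 →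
      (∀ u : ↥Pat, ‖(t u - p) - d • A (u : EuclideanSpace ℝ (Fin 3))‖ ≤ η * d) → d ≤ dist q p → dist q p ≤ 131 / 100 * d → ∃ u : ↥Pat, dist q (t u) < 100 / 101 * d)
    {η : ℝ} {A : EuclideanSpace ℝ (Fin 3) →ₗᵢ[ℝ] EuclideanSpace ℝ (Fin 3)} {τ : ↥Pat → Fin N} (hη : η < 1 / 20)
    (hτ₁ : ∀ u : ↥Pat, (bondGraph (1 / 100 : ℝ) y).Adj i (τ u))
    (hτ₂ : ∀ k : Fin N, (bondGraph (1 / 100 : ℝ) y).Adj i k → ∃ u : ↥Pat, τ u = k)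
    (hfit : ∀ u : ↥Pat, ‖(y (τ u) - y i) - nearestDist y i • A (u : EuclideanSpace ℝ (Fin 3))‖ ≤ η * nearestDist y i)
    (hPat : Pat.Nonempty) :
    0 < (nearestDist y i) ∧ 0 < (nearestDist y i / 100) ∧ η < 1 / 20 ∧ (∀ u : ↥Pat, (fun u => y (τ u)) u ∈ (Set.range y) ∧ ‖((fun u => y (τ u)) u - (y i)) - (nearestDist y i) • A (u : EuclideanSpace ℝ (Fin 3))‖ ≤ η * (nearestDist y i)) ∧ (∀ s : EuclideanSpace ℝ (Fin 3), s ∈ (Set.range y) → s ≠ (y i) → (nearestDist y i) ≤ dist s (y i)) ∧ (∃ s : EuclideanSpace ℝ (Fin 3), s ∈ (Set.range y) ∧ s ≠ (y i) ∧ dist s (y i) ≤ (nearestDist y i)) ∧ (∀ s : EuclideanSpace ℝ (Fin 3), s ∈ (Set.range y) → s ≠ (y i) → dist s (y i) < 13 / 10 * (nearestDist y i) + (nearestDist y i / 100) → dist s (y i) ≤ 13 / 10 * (nearestDist y i) - (nearestDist y i / 100) ∧ s ∈ Set.range (fun u => y (τ u))) := by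
  obtain ⟨u₀, hu₀⟩ := hPat
  have hki : τ ⟨u₀, hu₀⟩ ≠ i := fun h => (bondGraph_adj.1 (hτ₁ ⟨u₀, hu₀⟩)).1 h.symm
  -- the scale
  have hd : (7 : ℝ) / 10 ≤ nearestDist y i :=
    le_nearestDist ⟨_, hki⟩ fun k hk => hsep i k (fun h => hk h.symm)
  have hd0 : 0 < nearestDist y i := by linarith
  -- bonded neighbours: distance `≤ 101/100·d`, own scale `≥ 100/101·d`
  have hbond : ∀ k : Fin N, (bondGraph (1 / 100 : ℝ) y).Adj i k →
      dist (y i) (y k) ≤ (1 + 1 / 100) * nearestDist y i ∧ dist (y i) (y k) ≤ (1 + 1 / 100) * nearestDist y k := by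
    intro k hk
    obtain ⟨-, hle⟩ := bondGraph_adj.1 hk
    exact ⟨hle.trans (mul_le_mul_of_nonneg_left (min_le_left _ _) (by norm_num)),
      hle.trans (mul_le_mul_of_nonneg_left (min_le_right _ _) (by norm_num))⟩
  refine ⟨hd0, by positivity, hη, fun u => ⟨⟨τ u, rfl⟩, hfit u⟩, ?_, ?_, ?_⟩
  · -- `d ≤ dist s (y i)` for every other atom
    rintro _ ⟨k, rfl⟩ hk
    rw [dist_comm]
    exact nearestDist_le_dist y fun h => hk (by rw [h])
  · -- attained
    obtain ⟨k, hk, hkd⟩ := exists_nearestDist_eq_dist y ⟨_, hki⟩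
    exact ⟨y k, ⟨k, rfl⟩, fun h => hk (hy h), by rw [dist_comm, ← hkd]⟩
  · -- the clean gap at `13/10·d ± d/100`
    rintro _ ⟨k, rfl⟩ hk hlt
    have hki' : k ≠ i := fun h => hk (by rw [h])
    by_cases hadj : (bondGraph (1 / 100 : ℝ) y).Adj i k
    · obtain ⟨u, rfl⟩ := hτ₂ k hadj
      refine ⟨?_, ⟨u, rfl⟩⟩
      have := (hbond _ hadj).1
      rw [dist_comm] at this
      linarith
    · exfalso
      have hge : nearestDist y i ≤ dist (y k) (y i) := by
        rw [dist_comm]; exact nearestDist_le_dist y hki'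
      obtain ⟨u, hu⟩ := hgap hd0 hη.le hfit hge (by linarith)
      -- `τ u` is bonded to `i`, `k` is not: they differ, so `dist ≥ nn_(τ u) ≥ 100/101·d`
      have hne : k ≠ τ u := fun h => hadj (h ▸ hτ₁ u)
      have h1 : nearestDist y (τ u) ≤ dist (y (τ u)) (y k) := nearestDist_le_dist y hne
      have h2 := (hbond _ (hτ₁ u)).2
      have h3 : nearestDist y i ≤ dist (y i) (y (τ u)) :=
        nearestDist_le_dist y (fun h => (bondGraph_adj.1 (hτ₁ u)).1 h.symm)
      rw [dist_comm] at hu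
      linarith

/-- **`KR_shape → KR`.** [folklore] -/
theorem kr_of_krShape
    (hshape : ∀ (N : ℕ) (y : Fin N → EuclideanSpace ℝ (Fin 3)), Function.Injective y → (∀ a b : Fin N, a ≠ b → (7 : ℝ) / 10 ≤ dist (y a) (y b)) → ∀ i : Fin N, Literature.Geometry.DiscreteGeometry.IsChargeFree (1 / 100 : ℝ) y i → ∃ (η : ℝ) (A : EuclideanSpace ℝ (Fin 3) →ₗᵢ[ℝ] EuclideanSpace ℝ (Fin 3)), η < 1 / 20 ∧ ((∃ τ : ↥Literature.Geometry.DiscreteGeometry.fccKissingPattern → Fin N, (∀ u : ↥Literature.Geometry.DiscreteGeometry.fccKissingPattern, (Literature.Geometry.DiscreteGeometry.bondGraph (1 / 100 : ℝ) y).Adj i (τ u)) ∧ (∀ k : Fin N, (Literature.Geometry.DiscreteGeometry.bondGraph (1 / 100 : ℝ) y).Adj i k → ∃ u : ↥Literature.Geometry.DiscreteGeometry.fccKissingPattern, τ u = k) ∧ (∀ u : ↥Literature.Geometry.DiscreteGeometry.fccKissingPattern, ‖(y (τ u) - y i) - Literature.Geometry.DiscreteGeometry.nearestDist y i • A (u :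 EuclideanSpace ℝ (Fin 3))‖ ≤ η * Literature.Geometry.DiscreteGeometry.nearestDist y i)) ∨ (∃ τ : ↥Literature.Geometry.DiscreteGeometry.hcpKissingPattern → Fin N, (∀ u : ↥Literature.Geometry.DiscreteGeometry.hcpKissingPattern, (Literature.Geometry.DiscreteGeometry.bondGraph (1 / 100 : ℝ) y).Adj i (τ u)) ∧ (∀ k : Fin N, (Literature.Geometry.DiscreteGeometry.bondGraph (1 / 100 : ℝ) y).Adj i k → ∃ u : ↥Literature.Geometry.DiscreteGeometry.hcpKissingPattern, τ u = k) ∧ (∀ u : ↥Literature.Geometry.DiscreteGeometry.hcpKissingPattern, ‖(y (τ u) - y i) - Literature.Geometry.DiscreteGeometry.nearestDist y i • A (u : EuclideanSpace ℝ (Fin 3))‖ ≤ η * Literature.Geometry.DiscreteGeometry.nearestDist y i)))) :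
    ∀ (N : ℕ) (y : Fin N → EuclideanSpace ℝ (Fin 3)), Function.Injective y → (∀ a b : Fin N, a ≠ b → (7 : ℝ) / 10 ≤ dist (y a) (y b)) → ∀ i : Fin N, Literature.Geometry.DiscreteGeometry.IsChargeFree (1 / 100 : ℝ) y i → ∃ (d η γ : ℝ) (A : EuclideanSpace ℝ (Fin 3) →ₗᵢ[ℝ] EuclideanSpace ℝ (Fin 3)), (∃ t : ↥Literature.Geometry.DiscreteGeometry.fccKissingPattern → EuclideanSpace ℝ (Fin 3), 0 < d ∧ 0 < γ ∧ η < 1 / 20 ∧ (∀ u : ↥Literature.Geometry.DiscreteGeometry.fccKissingPattern, t u ∈ (Set.range y) ∧ ‖(t u - (y i)) - d • A (u : EuclideanSpace ℝ (Fin 3))‖ ≤ η * d) ∧ (∀ s : EuclideanSpace ℝ (Fin 3), s ∈ (Set.range y) → s ≠ (y i) → d ≤ dist s (y i)) ∧ (∃ s : EuclideanSpace ℝ (Fin 3), s ∈ (Set.range y) ∧ s ≠ (y i) ∧ dist s (y i) ≤ d) ∧ (∀ s : EuclideanSpace ℝ (Fin 3), s ∈ (Set.range y) → s ≠ (y i)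 → dist s (y i) < 13 / 10 * d + γ → dist s (y i) ≤ 13 / 10 * d - γ ∧ s ∈ Set.range t)) ∨ (∃ t : ↥Literature.Geometry.DiscreteGeometry.hcpKissingPattern → EuclideanSpace ℝ (Fin 3), 0 < d ∧ 0 < γ ∧ η < 1 / 20 ∧ (∀ u : ↥Literature.Geometry.DiscreteGeometry.hcpKissingPattern, t u ∈ (Set.range y) ∧ ‖(t u - (y i)) - d • A (u : EuclideanSpace ℝ (Fin 3))‖ ≤ η * d) ∧ (∀ s : EuclideanSpace ℝ (Fin 3), s ∈ (Set.range y) → s ≠ (y i) → d ≤ dist s (y i)) ∧ (∃ s : EuclideanSpace ℝ (Fin 3), s ∈ (Set.range y) ∧ s ≠ (y i) ∧ dist s (y i) ≤ d) ∧ (∀ s : EuclideanSpace ℝ (Fin 3), s ∈ (Set.range y) → s ≠ (y i) → dist s (y i) < 13 / 10 * d + γ → dist s (y i) ≤ 13 / 10 * d - γ ∧ s ∈ Set.range t)) := by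
  intro N y hy hsep i hcf
  obtain ⟨η, A, hη, hcase⟩ := hshape N y hy hsep i hcf
  rcases hcase with ⟨τ, hτ₁, hτ₂, hfit⟩ | ⟨τ, hτ₁, hτ₂, hfit⟩
  · exact ⟨nearestDist y i, η, nearestDist y i / 100, A, Or.inl ⟨fun u => y (τ u),
      robustGood_of_shape hy hsep (fun hd hη ht h1 h2 => thirteenth_neighbour_gap_fcc hd hη ht h1 h2) hη hτ₁ hτ₂ hfit
        (Finset.card_pos.1 (by rw [card_fccKissingPattern]; norm_num))⟩⟩
  · exact ⟨nearestDist y i, η, nearestDist y i / 100, A, Or.inr ⟨fun u => y (τ u),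
      robustGood_of_shape hy hsep (fun hd hη ht h1 h2 => thirteenth_neighbour_gap_hcp hd hη ht h1 h2) hη hτ₁ hτ₂ hfit
        (Finset.card_pos.1 (by rw [card_hcpKissingPattern]; norm_num))⟩⟩

/-- **`ChargedEnergyGap ∧ KR_shape ⟹ FDG`.** [folklore] -/
theorem frustrationDensityGap_of_chargedEnergyGap_of_krShape (hgap : ChargedEnergyGap)
    (hshape : ∀ (N : ℕ) (y : Fin N → EuclideanSpace ℝ (Fin 3)), Function.Injective y → (∀ a b : Fin N, a ≠ b → (7 : ℝ) / 10 ≤ dist (y a) (y b)) → ∀ i : Fin N, Literature.Geometry.DiscreteGeometry.IsChargeFree (1 / 100 : ℝ) y i → ∃ (η : ℝ) (A : EuclideanSpace ℝ (Fin 3) →ₗᵢ[ℝ] EuclideanSpace ℝ (Fin 3)), η < 1 / 20 ∧ ((∃ τ : ↥Literature.Geometry.DiscreteGeometry.fccKissingPattern → Fin N, (∀ u : ↥Literature.Geometry.DiscreteGeometry.fccKissingPattern, (Literature.Geometry.DiscreteGeometry.bondGraph (1 / 100 : ℝ) y).Adj i (τ u)) ∧ (∀ k : Fin N, (Literature.Geometry.DiscreteGeometry.bondGraph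 (1 / 100 : ℝ) y).Adj i k → ∃ u : ↥Literature.Geometry.DiscreteGeometry.fccKissingPattern, τ u = k) ∧ (∀ u : ↥Literature.Geometry.DiscreteGeometry.fccKissingPattern, ‖(y (τ u) - y i) - Literature.Geometry.DiscreteGeometry.nearestDist y i • A (u : EuclideanSpace ℝ (Fin 3))‖ ≤ η * Literature.Geometry.DiscreteGeometry.nearestDist y i)) ∨ (∃ τ : ↥Literature.Geometry.DiscreteGeometry.hcpKissingPattern → Fin N, (∀ u : ↥Literature.Geometry.DiscreteGeometry.hcpKissingPattern, (Literature.Geometry.DiscreteGeometry.bondGraph (1 / 100 : ℝ) y).Adj i (τ u)) ∧ (∀ k : Fin N, (Literature.Geometry.DiscreteGeometry.bondGraph (1 / 100 : ℝ) y).Adj i k → ∃ u : ↥Literature.Geometry.DiscreteGeometry.hcpKissingPattern, τ u = k) ∧ (∀ u : ↥Literature.Geometry.DiscreteGeometry.hcpKissingPattern, ‖(y (τ u) - y i) - Literature.Geometry.DiscreteGeometry.nearestDist y i • A (u : EuclideanSpace ℝ (Fin 3))‖ ≤ η * Literature.Geometry.DiscreteGeometry.nearestDist y i)))) :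
    ∃ κ : ℝ, 0 < κ ∧ ∃ C : ℝ, ∀ (N : ℕ) (y : Fin N → EuclideanSpace ℝ (Fin 3)), Function.Injective y → (∀ a b : Fin N, a ≠ b → (7 : ℝ) / 10 ≤ dist (y a) (y b)) → κ * N - C * (Nat.card {i : Fin N // ∃ (d η γ : ℝ) (A : EuclideanSpace ℝ (Fin 3) →ₗᵢ[ℝ] EuclideanSpace ℝ (Fin 3)), (∃ t : ↥Literature.Geometry.DiscreteGeometry.fccKissingPattern → EuclideanSpace ℝ (Fin 3), 0 < d ∧ 0 < γ ∧ η < 1 / 20 ∧ (∀ u : ↥Literature.Geometry.DiscreteGeometry.fccKissingPattern, t u ∈ (Set.range y) ∧ ‖(t u - (y i)) - d • A (u : EuclideanSpace ℝ (Fin 3))‖ ≤ η * d) ∧ (∀ s : EuclideanSpace ℝ (Fin 3), s ∈ (Set.range y) → s ≠ (y i) → d ≤ dist s (y i)) ∧ (∃ s : EuclideanSpace ℝ (Fin 3), s ∈ (Set.range y) ∧ s ≠ (y i) ∧ dist s (y i) ≤ d) ∧ (∀ s : EuclideanSpace ℝ (Fin 3), s ∈ (Set.range y) → s ≠ (y i)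 → dist s (y i) < 13 / 10 * d + γ → dist s (y i) ≤ 13 / 10 * d - γ ∧ s ∈ Set.range t)) ∨ (∃ t : ↥Literature.Geometry.DiscreteGeometry.hcpKissingPattern → EuclideanSpace ℝ (Fin 3), 0 < d ∧ 0 < γ ∧ η < 1 / 20 ∧ (∀ u : ↥Literature.Geometry.DiscreteGeometry.hcpKissingPattern, t u ∈ (Set.range y) ∧ ‖(t u - (y i)) - d • A (u : EuclideanSpace ℝ (Fin 3))‖ ≤ η * d) ∧ (∀ s : EuclideanSpace ℝ (Fin 3), s ∈ (Set.range y) → s ≠ (y i) → d ≤ dist s (y i)) ∧ (∃ s : EuclideanSpace ℝ (Fin 3), s ∈ (Set.range y) ∧ s ≠ (y i) ∧ dist s (y i) ≤ d) ∧ (∀ s : EuclideanSpace ℝ (Fin 3), s ∈ (Set.range y) → s ≠ (y i) → dist s (y i) < 13 / 10 * d + γ → dist s (y i) ≤ 13 / 10 * d - γ ∧ s ∈ Set.range t))} : ℝ) ≤ Literature.MathematicalPhysics.StatisticalMechanics.interactionEnergy Literature.MathematicalPhysics.StatisticalMechanics.lennardJones y - N * (⨅ Q : Literature.MathematicalPhysics.StatisticalMechanics.PeriodicConfiguration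 3, Q.energyPerParticle Literature.MathematicalPhysics.StatisticalMechanics.lennardJones) :=
  frustrationDensityGap_of_chargedEnergyGap hgap (kr_of_krShape hshape)

/-- **`AperiodicFrustratedLawGap` (crux of item 27623) BY NAME from `MuEquilibriumDoor ∧ ChargedEnergyGap ∧ KR_shape`.** [folklore] -/
theorem aperiodicFrustratedLawGap_of_chargedEnergyGap_of_krShape
    (hDoor : Summit.AtomisticToContinuum.Crystallization.Theses.GrainCoreNetworkSplit.MuEquilibriumDoor) (hgap : ChargedEnergyGap)
    (hshape : ∀ (N : ℕ) (y : Fin N → EuclideanSpace ℝ (Fin 3)), Function.Injective y → (∀ a b : Fin N, a ≠ b → (7 : ℝ) / 10 ≤ dist (y a) (y b)) → ∀ i : Fin N, Literature.Geometry.DiscreteGeometry.IsChargeFree (1 / 100 : ℝ) y i → ∃ (η : ℝ) (A : EuclideanSpace ℝ (Fin 3) →ₗᵢ[ℝ] EuclideanSpace ℝ (Fin 3)), η < 1 / 20 ∧ ((∃ τ : ↥Literature.Geometry.DiscreteGeometry.fccKissingPattern → Fin N, (∀ u : ↥Literature.Geometry.DiscreteGeometry.fccKissingPattern, (Literature.Geometry.DiscreteGeometry.bondGraph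 (1 / 100 : ℝ) y).Adj i (τ u)) ∧ (∀ k : Fin N, (Literature.Geometry.DiscreteGeometry.bondGraph (1 / 100 : ℝ) y).Adj i k → ∃ u : ↥Literature.Geometry.DiscreteGeometry.fccKissingPattern, τ u = k) ∧ (∀ u : ↥Literature.Geometry.DiscreteGeometry.fccKissingPattern, ‖(y (τ u) - y i) - Literature.Geometry.DiscreteGeometry.nearestDist y i • A (u : EuclideanSpace ℝ (Fin 3))‖ ≤ η * Literature.Geometry.DiscreteGeometry.nearestDist y i)) ∨ (∃ τ : ↥Literature.Geometry.DiscreteGeometry.hcpKissingPattern → Fin N, (∀ u : ↥Literature.Geometry.DiscreteGeometry.hcpKissingPattern, (Literature.Geometry.DiscreteGeometry.bondGraph (1 / 100 : ℝ) y).Adj i (τ u)) ∧ (∀ k : Fin N, (Literature.Geometry.DiscreteGeometry.bondGraph (1 / 100 : ℝ) y).Adj i k → ∃ u : ↥Literature.Geometry.DiscreteGeometry.hcpKissingPattern, τ u = k) ∧ (∀ u : ↥Literature.Geometry.DiscreteGeometry.hcpKissingPattern, ‖(y (τ u) - y i) - Literature.Geometry.DiscreteGeometry.nearestDist y i • A (u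 : EuclideanSpace ℝ (Fin 3))‖ ≤ η * Literature.Geometry.DiscreteGeometry.nearestDist y i)))) :
    Summit.AtomisticToContinuum.Crystallization.Theses.FrustratedLawDichotomy.AperiodicFrustratedLawGap :=
  aperiodicFrustratedLawGap_of_chargedEnergyGap hDoor hgap (kr_of_krShape hshape)

/-- **`NoFrustratedPeriodicMinimiser` (item 26654) from `ChargedEnergyGap ∧ KR_shape`, DOOR-FREE.** [folklore] -/
theorem noFrustratedPeriodicMinimiser_of_chargedEnergyGap_of_krShape (hgap : ChargedEnergyGap)
    (hshape : ∀ (N : ℕ) (y : Fin N → EuclideanSpace ℝ (Fin 3)), Function.Injective y → (∀ a b : Fin N, a ≠ b → (7 : ℝ) / 10 ≤ dist (y a) (y b)) → ∀ i : Fin N, Literature.Geometry.DiscreteGeometry.IsChargeFree (1 / 100 : ℝ) y i → ∃ (η : ℝ) (A : EuclideanSpace ℝ (Fin 3) →ₗᵢ[ℝ] EuclideanSpace ℝ (Fin 3)), η < 1 / 20 ∧ ((∃ τ : ↥Literature.Geometry.DiscreteGeometry.fccKissingPattern → Fin N, (∀ u : ↥Literature.Geometry.DiscreteGeometry.fccKissingPattern,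 (Literature.Geometry.DiscreteGeometry.bondGraph (1 / 100 : ℝ) y).Adj i (τ u)) ∧ (∀ k : Fin N, (Literature.Geometry.DiscreteGeometry.bondGraph (1 / 100 : ℝ) y).Adj i k → ∃ u : ↥Literature.Geometry.DiscreteGeometry.fccKissingPattern, τ u = k) ∧ (∀ u : ↥Literature.Geometry.DiscreteGeometry.fccKissingPattern, ‖(y (τ u) - y i) - Literature.Geometry.DiscreteGeometry.nearestDist y i • A (u : EuclideanSpace ℝ (Fin 3))‖ ≤ η * Literature.Geometry.DiscreteGeometry.nearestDist y i)) ∨ (∃ τ : ↥Literature.Geometry.DiscreteGeometry.hcpKissingPattern → Fin N, (∀ u : ↥Literature.Geometry.DiscreteGeometry.hcpKissingPattern, (Literature.Geometry.DiscreteGeometry.bondGraph (1 / 100 : ℝ) y).Adj i (τ u)) ∧ (∀ k : Fin N, (Literature.Geometry.DiscreteGeometry.bondGraph (1 / 100 : ℝ) y).Adj i k → ∃ u : ↥Literature.Geometry.DiscreteGeometry.hcpKissingPattern, τ u = k) ∧ (∀ u : ↥Literature.Geometry.DiscreteGeometry.hcpKissingPattern, ‖(y (τ u) - y i) - Literature.Geometry.DiscreteGeometry.nearestDist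 y i • A (u : EuclideanSpace ℝ (Fin 3))‖ ≤ η * Literature.Geometry.DiscreteGeometry.nearestDist y i)))) :
    Summit.AtomisticToContinuum.Crystallization.Theses.PeriodicChargeSplit.NoFrustratedPeriodicMinimiser :=
  noFrustratedPeriodicMinimiser_of_chargedEnergyGap hgap (kr_of_krShape hshape)

end Summit.AtomisticToContinuum.Crystallization.Theorems.FrustratedLawDichotomyKissingRigidityShape

end
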